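import Mathlib
import Summits.Ventures.PercRepro2.LocRows
import Summits.Ventures.PercRepro2.SwRow
import Summits.Ventures.PercRepro2.SwOut
import Summits.Ventures.PercRepro2.SwAllRow
import Summits.Ventures.PercRepro2.SwOutAll
import Summits.Ventures.PercRepro2.SwOutArmFlip
import Summits.Ventures.PercRepro2.SwOutArms
import Summits.Ventures.PercRepro2.SwOutArmOrbit
import Summits.Ventures.PercRepro2.SwOutArmCube
import Summits.Ventures.PercRepro2.SwOutArmThm
import Summits.Ventures.PercRepro2.SwOutCoreDefs
import Summits.Ventures.PercRepro2.SwOutCoreKey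
import Summits.Ventures.PercRepro2.SwOutCoreShadowUnion
import Summits.Ventures.PercRepro2.SwOutBigBlockDefs
import Summits.Ventures.PercRepro2.SwOutMixedBaseDefs
import Summits.Ventures.PercRepro2.SwOutMixedBaseClasses
import Summits.Ventures.PercRepro2.SwOutMixedBaseHull
import Summits.Ventures.PercRepro2.SwOutMixedBaseDual
import Summits.Ventures.PercRepro2.SwOutMixedCore
import Summits.Ventures.PercRepro2.SwOutMixedCoreMoves
import Summits.Ventures.PercRepro2.SwOutMixedPartCoreKey
import Summits.Ventures.PercRepro2.SwOutMixedPartOrbitDefs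
import Summits.Ventures.PercRepro2.SwOutMixedPartOrbit
import Summits.Ventures.PercRepro2.SwOutMixedPartArmsUnion

/-!
# The escaping points of a mixed block reach a core point along their coarse orbit (blind cell
PercRepro2, night-4 g19, 2026-08-27; proofs/NIGHT4-G19.md §5 (ii))

At an ESCAPING non-leaking point of a mixed base (the escaping cube
`D` or the antipodal pair, `p` outside the hull — `p_notMem_hull_esc`) the coarse arm of `u` is
`X = {u} ∪ ⋃ U_j` and the h-piece is a coarse arm (`armClosed_X_esc`, `armClosed_Ah_esc`); flipping the
h-piece toggles `a` and flipping `X` toggles the u-arms and the u–p edges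
(`flip_Ah_eq`, `flip_X_eq`), and a core point is reached by at most two such flips
(**`exists_core_mem_orbit`**: flip the h-piece when `a ≠ e`, then `X` on the escaping cube).
Hence every escaping point of a mixed block lies in the coarse orbit of a core point of the block
— the KEY of the mixed kind at an escaping point is the base of that core point.
-/

namespace Summit.Ventures.PercRepro2

namespace BigBlock

open Hull LocRows

variable {V : Type*} {E : Type*} [Fintype E] [DecidableEq E]

open scoped Classical

section Esc

variable {ι κ : Type*} {ends : E → Sym2 V} {σ : Config E} {h u p : V} {U : ι → Set V} {Ah : Set V}
  {F : κ → Set V}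

/-- The coarse arm of `u`: `u` with the u-arms. -/
def Xset (u : V) (U : ι → Set V) : Set V := {u} ∪ ⋃ j, U j

omit [Fintype E] [DecidableEq E] in
/-- An escaping point is unmixed. -/
lemma unmixed_of_esc {q : Pt ι κ} (hq : D q ∨ Pair q) : Unmixed q := by
  rcases hq with ⟨hs, _⟩ | ⟨hs, _, _⟩
  · cases he : q.2.2.2.1
    · right; intro j; rw [hs]; simp [he]
    · left; intro j; rw [hs]; simp [he]
  · cases he : q.2.2.2.1
    · left; intro j; rw [hs]; simp [he]
    · right; intro j; rw [hs]; simp [he]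

variable (hb : MixedBase ends σ h u p U Ah F)
include hb

omit [Fintype E] [DecidableEq E] in
/-- `p` lies outside the hull of `h` at an escaping point. -/
theorem MixedBase.p_notMem_hull_esc (hup : ∃ e, ends e = s(u, p)) {q : Pt ι κ}
    (hqR : ¬ LeakR q) (hqB : ¬ LeakB q) (hq : D q ∨ Pair q) :
    p ∉ hull ends (mixedReal ends u p U Ah F σ q) h := by
  have hne : ∀ q' : Pt ι κ, ((∃ j, q'.1 j = true) → q'.2.2.1 = false) →
      p ∉ redSetM h u p U Ah F q' := by
    intro q' hq' hp
    rw [mem_redSetM_iff] at hp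
    rcases hp with hp | ⟨j, _, hp⟩ | ⟨hp, _⟩ | ⟨_, hs, huP⟩ | ⟨_, hp⟩ | ⟨k, _, hp⟩
    · exact hb.hne_hp hp.symm
    · exact hb.p_notMem_U j hp
    · exact hb.hne_up hp.symm
    · rw [hq' hs] at huP; exact Bool.noConfusion huP
    · exact hb.p_notMem_Ah hp
    · exact hb.p_notMem_F k hp
  rintro (hp | hp)
  · rw [hb.cluster_mixedReal hup hqR] at hp
    refine hne q ?_ hp
    rintro ⟨j, hj⟩
    rcases hq with ⟨hs, huP⟩ | ⟨hs, _, huP⟩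
    · rw [congrFun hs j] at hj
      rw [huP, hj]
      rfl
    · rw [congrFun hs j, Bool.not_eq_true'] at hj
      rw [huP, hj]
  · rw [hb.cluster_blue_mixedReal hup hqB] at hp
    refine hne (flipPt q) ?_ hp
    rintro ⟨j, hj⟩
    simp only [flipPt, flipAll, Bool.not_eq_true', Bool.not_eq_false'] at hj ⊢
    rcases hq with ⟨hs, huP⟩ | ⟨hs, _, huP⟩
    · rw [congrFun hs j] at hj
      rw [huP, hj]
      rfl
    · rw [congrFun hs j, Bool.not_eq_false'] at hj
      rw [huP, hj]

omit [Fintype E] [DecidableEq E] in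
/-- `X` is arm-closed when `p` is outside the hull. -/
theorem MixedBase.armClosed_X_esc [Nonempty ι] (hup : ∃ e, ends e = s(u, p)) {q : Pt ι κ}
    (hqR : ¬ LeakR q) (hqB : ¬ LeakB q)
    (hpH : p ∉ hull ends (mixedReal ends u p U Ah F σ q) h) :
    ArmClosed ends (mixedReal ends u p U Ah F σ q) h (Xset u U) := by
  refine ⟨?_, ?_⟩
  · rintro x (hx | hx)
    · rw [Set.mem_singleton_iff] at hx
      rw [hx]
      exact ⟨hb.u_mem_hull hup hqR hqB, hb.hne_hu.symm⟩
    · obtain ⟨j, hj⟩ := Set.mem_iUnion.1 hx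
      exact ⟨hb.armsAll_subset_hull hup hqR hqB (Or.inl (Or.inl (Set.mem_iUnion.2 ⟨j, hj⟩))),
        fun h' => hb.h_notMem_U j (h' ▸ hj)⟩
  · rintro e x y hxy (hx | hx) hyH hyh
    · rw [Set.mem_singleton_iff] at hx
      rw [hx] at hxy
      rcases hb.u_edges e y hxy with ⟨j, hj⟩ | hyp
      · exact Or.inr (Set.mem_iUnion.2 ⟨j, hj⟩)
      · rw [hyp] at hyH; exact absurd hyH hpH
    · obtain ⟨j, hj⟩ := Set.mem_iUnion.1 hx
      have ht : e ∈ touches ends (U j) := ⟨x, hj, y, hxy⟩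
      obtain ⟨x', y', hxy', hx', hy'⟩ := hb.ends_of_touches_U ht
      -- `y` is `x'` or `y'`
      have hy2 : y = x' ∨ y = y' := by
        rw [hxy', Sym2.eq_iff] at hxy
        rcases hxy with ⟨_, h2⟩ | ⟨h1, _⟩
        · exact Or.inr h2.symm
        · exact Or.inl h1.symm
      rcases hy2 with rfl | rfl
      · exact Or.inr (Set.mem_iUnion.2 ⟨j, hx'⟩)
      · rcases hy' with hy' | rfl | rfl | ⟨_, _, _, hyo⟩
        · exact Or.inr (Set.mem_iUnion.2 ⟨j, hy'⟩)
        · exact absurd rfl hyh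
        · exact Or.inl rfl
        · exfalso
          have := hb.hull_mixedReal_subset hup hqR hqB hyH
          rcases this with ((h1 | h1) | h1) | h1
          · exact hyh h1
          · exact ‹y ≠ u› h1
          · exact ‹y ≠ p› h1
          · exact hyo h1

omit [Fintype E] [DecidableEq E] in
/-- The h-piece is arm-closed when `p` is outside the hull. -/
theorem MixedBase.armClosed_Ah_esc (hup : ∃ e, ends e = s(u, p)) {q : Pt ι κ}
    (hqR : ¬ LeakR q) (hqB : ¬ LeakB q)
    (hpH : p ∉ hull ends (mixedReal ends u p U Ah F σ q) h) :
    ArmClosed ends (mixedReal ends u p U Ah F σ q) h Ah := by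
  refine ⟨fun x hx => ⟨hb.armsAll_subset_hull hup hqR hqB (Or.inl (Or.inr hx)),
    fun h' => hb.h_notMem_Ah (h' ▸ hx)⟩, ?_⟩
  intro e x y hxy hx hyH hyh
  have ht : e ∈ touches ends Ah := ⟨x, hx, y, hxy⟩
  obtain ⟨x', y', hxy', hx', hy'⟩ := hb.ends_of_touches_Ah ht
  have hy2 : y = x' ∨ y = y' := by
    rw [hxy', Sym2.eq_iff] at hxy
    rcases hxy with ⟨_, h2⟩ | ⟨h1, _⟩
    · exact Or.inr h2.symm
    · exact Or.inl h1.symm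
  rcases hy2 with rfl | rfl
  · exact hx'
  · rcases hy' with hy' | rfl | rfl | ⟨_, _, _, hyo⟩
    · exact hy'
    · exact absurd rfl hyh
    · exact absurd hyH hpH
    · exfalso
      have := hb.hull_mixedReal_subset hup hqR hqB hyH
      rcases this with ((h1 | h1) | h1) | h1
      · exact hyh h1
      · exact ‹y ≠ u› h1
      · exact ‹y ≠ p› h1
      · exact hyo h1

omit hb [Fintype E] [DecidableEq E] in
/-- A point of the escaping cube is non-leaking (whatever the h-piece's colour). -/
lemma not_leak_of_D {q : Pt ι κ} (hq : D q) : ¬ LeakR q ∧ ¬ LeakB q := by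
  obtain ⟨s, a, uP, e, f⟩ := q
  obtain ⟨hs, huP⟩ := hq
  simp only at hs huP
  subst hs
  subst huP
  constructor
  · rintro ⟨⟨j, hj⟩, h2, _⟩
    simp only at hj h2
    rw [hj] at h2
    exact Bool.noConfusion h2
  · rintro ⟨⟨j, hj⟩, h2, _⟩
    simp only [flipPt, flipAll, Bool.not_eq_true'] at hj h2
    rw [hj] at h2
    exact Bool.noConfusion h2

omit [Fintype E] [DecidableEq E] in
/-- The flip of a union of coarse arms of a mixed-base realisation, as a cube point. -/
theorem MixedBase.flip_esc_eq [Nonempty ι] (hup : ∃ e, ends e = s(u, p))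
    (hdead : ∃ e y, ends e = s(p, y) ∧ y ∈ Ah)
    (hconnU : ∀ j, ∀ x ∈ U j, ∀ y ∈ U j,
      y ∈ cluster ends (fun e => decide (e ∈ within ends (U j))) x)
    (hconnA : ∀ x ∈ Ah, ∀ y ∈ Ah, y ∈ cluster ends (fun e => decide (e ∈ within ends Ah)) x)
    (hconnF : ∀ k, ∀ x ∈ F k, ∀ y ∈ F k,
      y ∈ cluster ends (fun e => decide (e ∈ within ends (F k))) x)
    {q : Pt ι κ} (hqR : ¬ LeakR q) (hqB : ¬ LeakB q) (hq : D q ∨ Pair q) :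
    flip ends Ah (mixedReal ends u p U Ah F σ q) =
        mixedReal ends u p U Ah F σ (q.1, !q.2.1, q.2.2.1, q.2.2.2.1, q.2.2.2.2) ∧
      flip ends (Xset u U) (mixedReal ends u p U Ah F σ q) =
        mixedReal ends u p U Ah F σ (flipAll q.1, q.2.1, !q.2.2.1, q.2.2.2.1, q.2.2.2.2) := by
  have hpH := hb.p_notMem_hull_esc hup hqR hqB hq
  obtain ⟨e₀, y₀, hey₀, hy₀⟩ := hdead
  constructor
  · rw [hb.flip_armClosed_eq_mixedReal hup ⟨e₀, y₀, hey₀, hy₀⟩ hconnU hconnA hconnF hqR hqB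
      (hb.armClosed_Ah_esc hup hqR hqB hpH)]
    congr 1
    have hUA : ∀ j, ¬ (U j ⊆ Ah) := by
      intro j hsub
      obtain ⟨x, hx⟩ := hb.U_nonempty j
      exact hb.U_disj_Ah j x hx (hsub hx)
    have hAA : Ah ⊆ Ah := Set.Subset.refl Ah
    have huA : u ∉ Ah := hb.u_notMem_Ah
    have hpA : p ∉ Ah := hb.p_notMem_Ah
    have hFA : ∀ k, ¬ (F k ⊆ Ah) := by
      intro k hsub
      obtain ⟨x, hx⟩ := hb.F_nonempty k
      exact hb.Ah_disj_F k x (hsub hx) hx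
    simp only [toggleW, hUA, hAA, huA, hpA, hFA, if_false, if_true]
  · rw [hb.flip_armClosed_eq_mixedReal hup ⟨e₀, y₀, hey₀, hy₀⟩ hconnU hconnA hconnF hqR hqB
      (hb.armClosed_X_esc hup hqR hqB hpH)]
    congr 1
    have hUX : ∀ j, U j ⊆ Xset u U := fun j x hx => Or.inr (Set.mem_iUnion.2 ⟨j, hx⟩)
    have hAX : ¬ (Ah ⊆ Xset u U) := by
      intro hsub
      rcases hsub hy₀ with hy | hy
      · exact hb.u_notMem_Ah (hy ▸ hy₀)
      · obtain ⟨j, hj⟩ := Set.mem_iUnion.1 hy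
        exact hb.U_disj_Ah j y₀ hj hy₀
    have huX : u ∈ Xset u U := Or.inl rfl
    have hpX : p ∉ Xset u U := by
      rintro (hp | hp)
      · exact hb.hne_up hp.symm
      · obtain ⟨j, hj⟩ := Set.mem_iUnion.1 hp
        exact hb.p_notMem_U j hj
    have hFX : ∀ k, ¬ (F k ⊆ Xset u U) := by
      intro k hsub
      obtain ⟨x, hx⟩ := hb.F_nonempty k
      rcases hsub hx with hy | hy
      · exact hb.u_notMem_F k (hy ▸ hx)
      · obtain ⟨j, hj⟩ := Set.mem_iUnion.1 hy
        exact hb.U_disj_F j k x hj hx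
    simp only [toggleW, hUX, hAX, huX, hpX, hFX, if_false, if_true]
    rfl

omit hb [DecidableEq E] in
/-- The orbit of the all-red orientation of an orbit point is the orbit of the base. -/
lemma allRed_of_mem_orbit {ζ ζ' : Config E} {h : V} (hc : CoreFree ends ζ h)
    (hζ' : ζ' ∈ orbit ends (allRed ends ζ h) h) : allRed ends ζ' h = allRed ends ζ h := by
  simp only [orbit, Finset.mem_image, Finset.mem_univ, true_and] at hζ'
  obtain ⟨ω, rfl⟩ := hζ'
  rw [allRed_orbitReal (coreFree_allRed hc), allRed_idem hc]

omit [DecidableEq E] in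
/-- **Every escaping point of a mixed block reaches a core point along its coarse orbit**: the
h-piece flipped when `a ≠ e`, then `X` flipped on the escaping cube. -/
theorem MixedBase.exists_core_mem_orbit [Nonempty ι] (hup : ∃ e, ends e = s(u, p))
    (hdead : ∃ e y, ends e = s(p, y) ∧ y ∈ Ah)
    (hconnU : ∀ j, ∀ x ∈ U j, ∀ y ∈ U j,
      y ∈ cluster ends (fun e => decide (e ∈ within ends (U j))) x)
    (hconnA : ∀ x ∈ Ah, ∀ y ∈ Ah, y ∈ cluster ends (fun e => decide (e ∈ within ends Ah)) x)
    (hconnF : ∀ k, ∀ x ∈ F k, ∀ y ∈ F k,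
      y ∈ cluster ends (fun e => decide (e ∈ within ends (F k))) x)
    {q : Pt ι κ} (hqR : ¬ LeakR q) (hqB : ¬ LeakB q) (hq : D q ∨ Pair q) :
    ∃ q' : Pt ι κ, Core q' ∧
      mixedReal ends u p U Ah F σ q' ∈ orbit ends (allRed ends (mixedReal ends u p U Ah F σ q) h) h := by
  have hc : CoreFree ends (mixedReal ends u p U Ah F σ q) h :=
    hb.coreFree_of_unmixed hup hqR hqB (unmixed_of_esc hq)
  have hpH := hb.p_notMem_hull_esc hup hqR hqB hq
  obtain ⟨hAh, hX⟩ := hb.flip_esc_eq hup hdead hconnU hconnA hconnF hqR hqB hq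
  -- the flip of the h-piece and of `X` are orbit points
  have hAh_mem : flip ends Ah (mixedReal ends u p U Ah F σ q) ∈
      orbit ends (allRed ends (mixedReal ends u p U Ah F σ q) h) h := by
    have hAh_eq := armClosed_eq_armsUnion (hb.armClosed_Ah_esc hup hqR hqB hpH)
    have := flip_armsUnion_mem_orbit hc (fun Q => Q ⊆ Ah)
    rw [← hAh_eq] at this
    exact this
  have hX_mem : flip ends (Xset u U) (mixedReal ends u p U Ah F σ q) ∈
      orbit ends (allRed ends (mixedReal ends u p U Ah F σ q) h) h := by
    have hX_eq := armClosed_eq_armsUnion (hb.armClosed_X_esc hup hqR hqB hpH)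
    have := flip_armsUnion_mem_orbit hc (fun Q => Q ⊆ Xset u U)
    rw [← hX_eq] at this
    exact this
  rcases hq with hD | hP
  · obtain ⟨hs, huP⟩ := hD
    by_cases hae : q.2.1 = q.2.2.2.1
    · -- flip `X`
      refine ⟨_, ?_, hX ▸ hX_mem⟩
      refine ⟨?_, ?_⟩
      · simp only [huP, hae, Bool.not_not]
      · simp only [huP, Bool.not_not]
    · -- flip the h-piece, then `X`
      set q₁ : Pt ι κ := (q.1, !q.2.1, q.2.2.1, q.2.2.2.1, q.2.2.2.2) with hq₁
      have hD₁ : D q₁ := ⟨hs, huP⟩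
      have hq₁R := (not_leak_of_D hD₁).1
      have hq₁B := (not_leak_of_D hD₁).2
      have hmem₁ : mixedReal ends u p U Ah F σ q₁ ∈
          orbit ends (allRed ends (mixedReal ends u p U Ah F σ q) h) h := hAh ▸ hAh_mem
      obtain ⟨_, hX₁⟩ := hb.flip_esc_eq hup hdead hconnU hconnA hconnF hq₁R hq₁B (Or.inl hD₁)
      have hc₁ : CoreFree ends (mixedReal ends u p U Ah F σ q₁) h :=
        hb.coreFree_of_unmixed hup hq₁R hq₁B (unmixed_of_esc (Or.inl hD₁))
      have hpH₁ := hb.p_notMem_hull_esc hup hq₁R hq₁B (Or.inl hD₁)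
      have hX₁_mem : flip ends (Xset u U) (mixedReal ends u p U Ah F σ q₁) ∈
          orbit ends (allRed ends (mixedReal ends u p U Ah F σ q₁) h) h := by
        have hX_eq := armClosed_eq_armsUnion (hb.armClosed_X_esc hup hq₁R hq₁B hpH₁)
        have := flip_armsUnion_mem_orbit hc₁ (fun Q => Q ⊆ Xset u U)
        rw [← hX_eq] at this
        exact this
      rw [allRed_of_mem_orbit hc hmem₁] at hX₁_mem
      refine ⟨_, ?_, hX₁ ▸ hX₁_mem⟩
      refine ⟨?_, ?_⟩
      · simp only [hq₁, huP, Bool.not_not]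
        cases ha : q.2.1 <;> cases he : q.2.2.2.1 <;> simp_all
      · simp only [hq₁, huP, Bool.not_not]
  · -- the pair: flip the h-piece
    obtain ⟨_, ha, huP⟩ := hP
    refine ⟨_, ?_, hAh ▸ hAh_mem⟩
    refine ⟨?_, ?_⟩
    · simp only [ha, huP, Bool.not_not]
    · simp only [huP]

end Esc

end BigBlock

end Summit.Ventures.PercRepro2
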